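import Literature.Geometry.Symplectic.SteinLiouville
import Literature.Geometry.Symplectic.SteinDomainShrinking
import Literature.Geometry.Kaehler.ManifoldFormsFunSmulProofs
import Mathlib.Analysis.Calculus.Deriv.MeanValue
import HarnessLib

/-!
# Reparametrising the `J`-convex function of a Stein domain: `f ∘ φ` is `J`-convex

Topic `Literature/Geometry/Symplectic`; proofs file of the fact seat of
`Literature.Geometry.Symplectic.Gompf1998_thm13_twoHandles` (**E2**, `SteinTwoHandles.lean`).
The printed proofs of E2 (Eliashberg 1990; Cieliebak–Eliashberg 2012, Ch. 8) work on an *open*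
complex surface `V` with an *exhausting* `J`-convex function `ψ` and attach handles to a regular
sublevel set `{ψ ≤ c}`; the tree's base is a compact Stein domain `(W, J, φ)` whose boundary is
the maximal level of `φ`.  The passage between the two uses that **composing a `J`-convex
function with a convex increasing function of one variable gives a `J`-convex function** (the
Levi form of `f ∘ φ` on `(v, Jv)` is `f'(φ) · Levi(φ)(v, Jv) + f''(φ) (dφ(v)² + dφ(Jv)²)`),
e.g. with `f(t) → ∞` as `t → max φ` to exhaust `int W`.  This file proves that identity for the
tree's `d^ℂ`, `-dd^ℂ` (`SteinDomain.lean`) and packages the reparametrised Stein structure: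

* `rd φ x` — the differential `dφ_x` of a real function read as a functional `ℝ⁴ →L ℝ`
  (Mathlib's `mfderiv`, whose values live in the tangent spaces `T_{φ x}ℝ = ℝ`);
* `rd_real_comp_apply` — chain rule `d(f ∘ φ) = f'(φ) dφ` for `f : ℝ → ℝ`;
* `dComplex_real_comp` — `d^ℂ(f ∘ φ) = (f' ∘ φ) • d^ℂφ`;
* `levi_real_comp` — **the Levi form of `f ∘ φ`**:
  `-dd^ℂ(f ∘ φ)(v, Jv) = f'(φ) (-dd^ℂφ(v, Jv)) + f''(φ) (dφ(v)² + dφ(Jv)²)` (Leibniz rule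
  `d(ρ α) = ρ dα + dρ ∧ α`, `Kaehler.mextDeriv_fun_smul_apply`, and `J² = -1`);
* `levi_real_comp_pos` — hence `f ∘ φ` is `J`-convex at `x` if `φ` is, `f'(φ x) > 0` and
  `f''(φ x) ≥ 0`;
* `SteinStructure.reparam` — **the Stein structure `(J, f ∘ φ)`** for `f` smooth with `f' > 0`,
  `f'' ≥ 0`: same `J`, the boundary is still the (regular) maximal level.

Everything is **proved**; no named fact.

## References

* K. Cieliebak, Ya. Eliashberg, *From Stein to Weinstein and Back*, AMS Colloquium Publ. 59
  (2012), §2–§3 (`J`-convex functions; composition with convex increasing functions;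
  exhausting `J`-convex functions on Stein domains). [CieliebakEliashberg2012]
* K. Fritzsche, H. Grauert, *From Holomorphic Functions to Complex Manifolds*, GTM 213 (2002),
  Ch. II (plurisubharmonic functions, the Levi form, composition with convex increasing
  functions). [folklore]
-/

noncomputable section

open scoped Manifold ContDiff Topology
open Set Function Filter

namespace Literature.Geometry.Symplectic

open Literature.Geometry.Kaehler Literature.LinearAlgebra.Alternating

variable {W : Type*} [TopologicalSpace W] [ChartedSpace (EuclideanHalfSpace 4) W]
  [IsManifold (𝓡∂ 4) ∞ W]

/-! ### The differential of a real function, read in `ℝ` -/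

/-- **The differential `dφ_x : T_xW = ℝ⁴ → ℝ` of a real function**, Mathlib's `mfderiv` read as
a functional into `ℝ` (its values natively live in `T_{φ x}ℝ`, which *is* `ℝ`).  The
`SteinStructure.dφ` of `SteinBoundaryContact.lean` is `rd S.φ`. [folklore] -/
abbrev rd (φ : W → ℝ) (x : W) : EuclideanSpace ℝ (Fin 4) →L[ℝ] ℝ :=
  mfderiv (𝓡∂ 4) 𝓘(ℝ, ℝ) φ x

omit [IsManifold (𝓡∂ 4) ∞ W] in
/-- `d^ℂφ_x(w) = dφ_x(J w)` in terms of `rd`. [folklore] -/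
theorem dComplex_apply_rd (J : (x : W) → (EuclideanSpace ℝ (Fin 4) →L[ℝ] EuclideanSpace ℝ (Fin 4)))
    (φ : W → ℝ) (x : W) (w : EuclideanSpace ℝ (Fin 4)) :
    @Eq ℝ (dComplex J φ x ![w]) (rd φ x (J x w)) :=
  rfl

omit [IsManifold (𝓡∂ 4) ∞ W] in
/-- **Chain rule `d(f ∘ φ)_x = f'(φ x) · dφ_x`** for `φ : W → ℝ` differentiable at `x` and
`f : ℝ → ℝ` differentiable at `φ x`. [folklore] -/
theorem rd_real_comp_apply {φ : W → ℝ} {f : ℝ → ℝ} {x : W}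
    (hφ : MDifferentiableAt (𝓡∂ 4) 𝓘(ℝ, ℝ) φ x) (hf : DifferentiableAt ℝ f (φ x))
    (v : EuclideanSpace ℝ (Fin 4)) :
    rd (f ∘ φ) x v = deriv f (φ x) * rd φ x v := by
  have hfm : HasMFDerivAt 𝓘(ℝ, ℝ) 𝓘(ℝ, ℝ) f (φ x)
      (ContinuousLinearMap.smulRight (1 : ℝ →L[ℝ] ℝ) (deriv f (φ x)) :) :=
    hf.hasDerivAt.hasFDerivAt.hasMFDerivAt
  have h := (hfm.comp x hφ.hasMFDerivAt).mfderiv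
  show (mfderiv (𝓡∂ 4) 𝓘(ℝ, ℝ) (f ∘ φ) x) v = deriv f (φ x) * rd φ x v
  rw [h]
  show @HSMul.hSMul ℝ ℝ ℝ instHSMul (rd φ x v) (deriv f (φ x)) = deriv f (φ x) * rd φ x v
  rw [smul_eq_mul, mul_comm]

omit [IsManifold (𝓡∂ 4) ∞ W] in
/-- **`d^ℂ(f ∘ φ) = (f' ∘ φ) • d^ℂφ`** when `φ` is differentiable and `f` is differentiable on
the range of `φ`. [cite: CieliebakEliashberg2012, §2] -/
theorem dComplex_real_comp (J : (x : W) → (EuclideanSpace ℝ (Fin 4) →L[ℝ] EuclideanSpace ℝ (Fin 4)))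
    {φ : W → ℝ} {f : ℝ → ℝ} (hφ : MDifferentiable (𝓡∂ 4) 𝓘(ℝ, ℝ) φ)
    (hf : ∀ x, DifferentiableAt ℝ f (φ x)) :
    dComplex J (f ∘ φ) = (deriv f ∘ φ) • dComplex J φ := by
  funext x
  ext w
  have h1 : @Eq ℝ (dComplex J (f ∘ φ) x w) (rd (f ∘ φ) x (J x (w 0))) := rfl
  have h2 : @Eq ℝ (((deriv f ∘ φ) • dComplex J φ) x w) (deriv f (φ x) * rd φ x (J x (w 0))) := rfl
  rw [h1, h2]
  exact rd_real_comp_apply (hφ x) (hf x) _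

/-! ### The Levi form of `f ∘ φ` -/

omit [IsManifold (𝓡∂ 4) ∞ W] in
/-- The wedge of a `1`-form with a `1`-form on a pair: `(θ ∧ η)(a, b) = θ(a) η(b) - θ(b) η(a)`.
[folklore] -/
theorem wedgeOne_one_apply_pair (θ : EuclideanSpace ℝ (Fin 4) →L[ℝ] ℝ)
    (η : EuclideanSpace ℝ (Fin 4) [⋀^Fin 1]→L[ℝ] ℝ) (a b : EuclideanSpace ℝ (Fin 4)) :
    wedgeOne θ η ![a, b] = θ a * η ![b] - θ b * η ![a] := by
  rw [wedgeOne_apply, Fin.sum_univ_two]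
  have h0 : Fin.removeNth (0 : Fin 2) ![a, b] = ![b] := by funext i; fin_cases i; rfl
  have h1 : Fin.removeNth (1 : Fin 2) ![a, b] = ![a] := by funext i; fin_cases i; rfl
  simp only [Fin.val_zero, pow_zero, one_smul, Matrix.cons_val_zero, Fin.val_one, pow_one,
    neg_smul, Matrix.cons_val_one, Matrix.cons_val_fin_one, h0, h1, smul_eq_mul]
  ring

/-- **The Levi form of `f ∘ φ`.**  Let `J` preserve smooth vector fields with `J² = -1`, `φ` be
smooth and `f : ℝ → ℝ` of class `C²`.  Then at every `x`, for every `v`: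
`-dd^ℂ(f ∘ φ)_x(v, Jv) = f'(φ x) · (-dd^ℂφ_x(v, Jv)) + f''(φ x) · (dφ_x(v)² + dφ_x(Jv)²)`.
Proof: `d^ℂ(f ∘ φ) = ρ • d^ℂφ` with `ρ = f' ∘ φ`; Leibniz `d(ρ α) = ρ dα + dρ ∧ α`
(`Kaehler.mextDeriv_fun_smul_apply`) with `dρ = f''(φ) dφ`; and
`(dφ ∧ d^ℂφ)(v, Jv) = dφ(v) dφ(J²v) - dφ(Jv) dφ(Jv) = -(dφ(v)² + dφ(Jv)²)`.
[cite: CieliebakEliashberg2012, §2] -/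
theorem levi_real_comp [T2Space W]
    {J : (x : W) → (EuclideanSpace ℝ (Fin 4) →L[ℝ] EuclideanSpace ℝ (Fin 4))}
    (hJ : PreservesSmoothFields J) (hJ2 : ∀ x v, J x (J x v) = -v) {φ : W → ℝ}
    (hφ : ContMDiff (𝓡∂ 4) 𝓘(ℝ, ℝ) ∞ φ) {f : ℝ → ℝ} (hf : ContDiff ℝ 2 f) (x : W)
    (v : EuclideanSpace ℝ (Fin 4)) :
    -(mextDeriv (dComplex J (f ∘ φ)) x ![v, J x v]) =
      deriv f (φ x) * -(mextDeriv (dComplex J φ) x ![v, J x v]) +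
        deriv (deriv f) (φ x) * (rd φ x v ^ 2 + rd φ x (J x v) ^ 2) := by
  -- differentiability facts
  have hφd : MDifferentiable (𝓡∂ 4) 𝓘(ℝ, ℝ) φ := hφ.mdifferentiable (by simp)
  have hf1 : Differentiable ℝ f := hf.differentiable (by simp)
  have hf' : ContDiff ℝ 1 (deriv f) := (contDiff_succ_iff_deriv.1 hf).2.2
  have hf'd : Differentiable ℝ (deriv f) := hf'.differentiable (by simp)
  set ρ : W → ℝ := deriv f ∘ φ with hρ
  have hρd : MDifferentiableAt (𝓡∂ 4) 𝓘(ℝ, ℝ) ρ x :=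
    ((hf'd (φ x)).hasDerivAt.hasFDerivAt.hasMFDerivAt.comp x (hφd x).hasMFDerivAt).mdifferentiableAt
  -- `d^ℂ(f ∘ φ) = ρ • d^ℂφ`
  have hcomp : dComplex J (f ∘ φ) = ρ • dComplex J φ := dComplex_real_comp J hφd fun x => hf1 _
  have hα : MForm.SmoothAt (dComplex J φ) x := isSmoothForm_dComplex_of_preservesSmoothFields hJ hφ x
  -- the differential of `ρ` read in the chart at `x` is `f''(φ x) dφ_x`
  set θ : EuclideanSpace ℝ (Fin 4) →L[ℝ] ℝ :=
    fderivWithin ℝ (ρ ∘ (extChartAt (𝓡∂ 4) x).symm) (range (𝓡∂ 4)) (extChartAt (𝓡∂ 4) x x) with hθdef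
  have hθ : ∀ w, θ w = deriv (deriv f) (φ x) * rd φ x w := by
    intro w
    have h1 : θ w = rd ρ x w := by
      show θ w = (mfderiv (𝓡∂ 4) 𝓘(ℝ, ℝ) ρ x) w
      rw [hρd.mfderiv]
      rfl
    rw [h1]
    exact rd_real_comp_apply (hφd x) (hf'd (φ x)) w
  -- Leibniz rule on `(v, Jv)`, read with the vectors typed in `ℝ⁴`
  have hprod : -(mextDeriv (ρ • dComplex J φ) x ![v, J x v]) =
      -(ρ x * mextDeriv (dComplex J φ) x ![v, J x v] + wedgeOne θ (dComplex J φ x) ![v, J x v]) := by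
    have h := mextDeriv_fun_smul_apply hρd hα ![v, J x v]
    exact congrArg Neg.neg h
  -- evaluate the wedge on `(v, Jv)`
  have hw0 : wedgeOne θ (dComplex J φ x) ![v, J x v] =
      θ v * dComplex J φ x ![J x v] - θ (J x v) * dComplex J φ x ![v] :=
    wedgeOne_one_apply_pair θ (dComplex J φ x) v (J x v)
  have e1 : dComplex J φ x ![J x v] = -rd φ x v := by
    show rd φ x (J x (J x v)) = -rd φ x v
    rw [hJ2, map_neg]
  have e2 : dComplex J φ x ![v] = rd φ x (J x v) := rfl
  have hρx : ρ x = deriv f (φ x) := rfl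
  rw [hcomp, hprod, hw0, hθ v, hθ (J x v), e1, e2, hρx]
  ring

/-- **`f ∘ φ` is `J`-convex where `φ` is, if `f' > 0` and `f'' ≥ 0` there.**
[cite: CieliebakEliashberg2012, §2] -/
theorem levi_real_comp_pos [T2Space W]
    {J : (x : W) → (EuclideanSpace ℝ (Fin 4) →L[ℝ] EuclideanSpace ℝ (Fin 4))}
    (hJ : PreservesSmoothFields J) (hJ2 : ∀ x v, J x (J x v) = -v) {φ : W → ℝ}
    (hφ : ContMDiff (𝓡∂ 4) 𝓘(ℝ, ℝ) ∞ φ) {f : ℝ → ℝ} (hf : ContDiff ℝ 2 f) {x : W}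
    (hconv : ∀ v : EuclideanSpace ℝ (Fin 4), v ≠ 0 → 0 < -(mextDeriv (dComplex J φ) x ![v, J x v]))
    (hf' : 0 < deriv f (φ x)) (hf'' : 0 ≤ deriv (deriv f) (φ x))
    {v : EuclideanSpace ℝ (Fin 4)} (hv : v ≠ 0) :
    0 < -(mextDeriv (dComplex J (f ∘ φ)) x ![v, J x v]) := by
  rw [levi_real_comp hJ hJ2 hφ hf x v]
  have h1 := hconv v hv
  have h2 : 0 ≤ deriv (deriv f) (φ x) * (rd φ x v ^ 2 + rd φ x (J x v) ^ 2) :=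
    mul_nonneg hf'' (by positivity)
  nlinarith [mul_pos hf' h1]

/-! ### The reparametrised Stein structure `(J, f ∘ φ)` -/

namespace SteinStructure

variable [CompactSpace W] (S : SteinStructure W)

/-- The maximum of `f ∘ φ` is `f (max φ)` for `f` continuous and monotone (`W ≠ ∅`). [folklore] -/
theorem sSup_range_real_comp [Nonempty W] {f : ℝ → ℝ} (hfc : Continuous f) (hfm : Monotone f) :
    sSup (range (f ∘ S.φ)) = f (sSup (range S.φ)) := by
  rw [range_comp]
  exact (hfm.map_csSup_of_continuousAt hfc.continuousAt (range_nonempty S.φ) S.bddAbove_range_φ).symm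

variable [T2Space W]

/-- **The Stein structure `(J, f ∘ φ)`** obtained by reparametrising the `J`-convex function
along a smooth `f : ℝ → ℝ` with `f' > 0` and `f'' ≥ 0`: `J` and its axioms are unchanged,
`f ∘ φ` is smooth and `J`-convex (`levi_real_comp_pos`), the boundary is the maximal level of
`f ∘ φ` (`f` is strictly increasing) and a regular one (`d(f ∘ φ) = f'(φ) dφ`, `f' ≠ 0`).
[cite: CieliebakEliashberg2012, §2] -/
def reparam {f : ℝ → ℝ} (hf : ContDiff ℝ ∞ f) (hf' : ∀ t, 0 < deriv f t)
    (hf'' : ∀ t, 0 ≤ deriv (deriv f) t) : SteinStructure W where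
  J := S.J
  φ := f ∘ S.φ
  J_sq := S.J_sq
  J_smooth := S.J_smooth
  integrable := S.integrable
  φ_smooth := hf.comp_contMDiff S.φ_smooth
  convex x v hv :=
    levi_real_comp_pos S.preservesSmoothFields S.J_sq S.φ_smooth (hf.of_le (by norm_cast))
      (fun w hw => S.convex x w hw) (hf' _) (hf'' _) hv
  boundary_eq x := by
    haveI : Nonempty W := ⟨x⟩
    have hmono : StrictMono f := strictMono_of_deriv_pos hf'
    rw [S.sSup_range_real_comp hf.continuous hmono.monotone, S.boundary_eq x]
    exact ⟨fun h => congrArg f h, fun h => hmono.injective h⟩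
  regular x hx := by
    have hφd : MDifferentiableAt (𝓡∂ 4) 𝓘(ℝ, ℝ) S.φ x := (S.φ_smooth x).mdifferentiableAt (by simp)
    have hf1 : DifferentiableAt ℝ f (S.φ x) := (hf.differentiable (by simp)) _
    intro h0
    apply S.regular x hx
    have key : ∀ w, rd S.φ x w = 0 := fun w => by
      have h1 := rd_real_comp_apply hφd hf1 w
      have h2 : rd (f ∘ S.φ) x w = 0 := by
        show (mfderiv (𝓡∂ 4) 𝓘(ℝ, ℝ) (f ∘ S.φ) x) w = 0
        rw [h0]
        rfl
      rw [h2] at h1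
      rcases mul_eq_zero.1 h1.symm with h | h
      · exact absurd h (hf' _).ne'
      · exact h
    exact ContinuousLinearMap.ext fun w => key w

/-- The `J` of the reparametrised structure is the original one. [folklore] -/
theorem reparam_J {f : ℝ → ℝ} (hf : ContDiff ℝ ∞ f) (hf' : ∀ t, 0 < deriv f t)
    (hf'' : ∀ t, 0 ≤ deriv (deriv f) t) : (S.reparam hf hf' hf'').J = S.J := rfl

/-- The function of the reparametrised structure is `f ∘ φ`. [folklore] -/
theorem reparam_φ {f : ℝ → ℝ} (hf : ContDiff ℝ ∞ f) (hf' : ∀ t, 0 < deriv f t)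
    (hf'' : ∀ t, 0 ≤ deriv (deriv f) t) : (S.reparam hf hf' hf'').φ = f ∘ S.φ := rfl

end SteinStructure

end Literature.Geometry.Symplectic

end
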